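import Summits.BirchSwinnertonDyer.BirchSwinnertonDyer.Theorems.ThetaPartnerAtTwoMazurTateCongruenceAtTwoRFourFacts
import Literature.NumberTheory.EllipticCurves.Gamma0CocycleDegeneracyMaps
import HarnessLib

/-!
# Crux `MazurTateCongruenceAtTwoTop` (stmt-BirchSwinnertonDyer-25797 = `MazurTateCongruenceAtTwoR` 21416), K1 row of route
# `ThetaPartnerAtTwo`: the expanded `S₀`-depleted plus table along `Γ₀(N·∏q_v²)`-translates — Manin bookkeeping for the
# depletion-injectivity road (width seat bsd-wall-tp2-p1-w2 g3; `--supports stmt-BirchSwinnertonDyer-25797`; closes nothing)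

THEOREMS ONLY; nothing is asserted about any curve; BSD is not proved by any of this. Consumed by the sequel
`…RSymbolMuOfDepletionInjective` (`Hμ` from depletion-injectivity mod `2`).

* §1 `map_ratPlusSymbol_smul_mul_eq` — Manin's relation for the conjugate `δ = diag(t,1)γdiag(t,1)⁻¹ ∈ Γ₀(N)`
  (`Gamma0.degeneracyConjElt`) of `γ ∈ Γ₀(L)`, `N·t ∣ L`, read at the dilated point: `j[(γx)·t]⁺_f = 𝟙_{c≠0}·j[δ∞]⁺_f + j[x·t]⁺_f`;
  and `[δ∞]⁺_f = m_δ/2` when `re{∞, δ∞}_f = m_δ·Ω⁺_f/2` (`ratPlusSymbol_maninCusp_eq_half_of_re`).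
* §2 `depletedTable_gamma0_smul` — for `γ ∈ Γ₀(N·∏_{v∈S₀} q_v²)` with `c(γ) ≠ 0` and `cx + d ≠ 0`:
  `Ψ^{S₀}(γx) = Ψ^{S₀}(x) + Σ_{k∈{0,1,2}^{S₀}} C_k·(m_{δ_k}/2)` in `ℚ̄₂`, `C_k = ∏_v coeff_{k_v}(P_v)·q_v^{−k_v}`, `δ_k` the conjugate by
  `diag(t_k,1)`, `t_k = ∏ q_v^{k_v}`; `(2∏q_v²)·Σ_k C_k·(m_k/2)` is the INTEGER `R = Σ_k (∏_v coeff_{k_v}(P_v)·q_v^{2−k_v})·m_k`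
  (`two_mul_prod_sq_mul_sum_depletionCoeff_eq_intCast`), and `R mod 2 = Σ_k (∏_v c̄oeff_{k_v}(P_v))·m̄_k` for odd `q_v`
  (`intCast_sum_depletionCoeff_mul_zmod_two`).
* §3 four small norm facts in `ℚ̄₂` (odd integers are units; `‖S‖ = 2` from `Q·S = R`; the ultrametric dichotomy).

References: [Manin1972] Thm. 1.9; [CremonaAlgorithms1997] §2.4 (2.4.1)–(2.4.2), §2.8; [GreenbergVatsal2000] §1 (8);
[DarmonDiamondTaylor1995] Lemma 4.28 (p. 135) (the degeneracy conjugation).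
-/

-- justification: the `Summit.BirchSwinnertonDyer.BirchSwinnertonDyer.…` path repeats a component (route-file convention)
set_option linter.dupNamespace false
set_option autoImplicit false

noncomputable section

open scoped Classical MatrixGroups ModularForm

open CongruenceSubgroup Polynomial WeierstrassCurve NumberField IsDedekindDomain
  Literature.NumberTheory.IwasawaTheory Literature.NumberTheory.EllipticCurves Literature.NumberTheory.EllipticCurves.ModularForms
  Literature.NumberTheory.EllipticCurves.Rank1Residual Literature.NumberTheory.EllipticCurves.GreenbergVatsal2000
  Summit.BirchSwinnertonDyer.Rank1Residual.Supersingular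
  Summit.BirchSwinnertonDyer.BirchSwinnertonDyer.Theorems.ThetaLayerLambdaCongruenceAtTwo

namespace Summit.BirchSwinnertonDyer.BirchSwinnertonDyer.Theorems.MazurTateCongruenceAtTwoR

/-! ## §1. Manin's relation for the dilated conjugate -/

section Manin

variable {N : ℕ} [NeZero N] (f : CuspForm (Gamma0 N) 2)

/-- **The cusp value at `δ∞` is `m_δ/2`** for the integer `m_δ` with `re{∞, δ∞}_f = m_δ·Ω⁺_f/2` (rational normalised newform;
`c(δ) ≠ 0`). Same computation as `exists_ratPlusSymbol_maninCusp_eq_half`, with the integer named. [cite: CremonaAlgorithms1997, §2.8] -/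
theorem ratPlusSymbol_maninCusp_eq_half_of_re (hf : IsNewform0 f) (hQ : coeffField f = ⊥) (δ : Gamma0 N)
    (hc : (δ : SL(2, ℤ)) 1 0 ≠ 0) {m : ℤ} (hm : (cuspSymbol f δ).re = m * (plusPeriod f / 2)) :
    ratPlusSymbol f ((((δ : SL(2, ℤ)) 0 0 : ℚ)) / (((δ : SL(2, ℤ)) 1 0 : ℚ))) = (m : ℚ) / 2 := by
  have hreal : ∀ n, (cuspCoeff f n).im = 0 := cuspCoeff_im_eq_zero_of_coeffField_eq_bot hQ
  have hΩ : plusPeriod f ≠ 0 := (IsNewform0.plusPeriod_pos_holds hf hQ).ne'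
  have hcusp : cuspSymbol f δ = modularSymbol f ((((δ : SL(2, ℤ)) 0 0 : ℚ)) / (((δ : SL(2, ℤ)) 1 0 : ℚ))) := by
    unfold cuspSymbol
    rw [if_neg hc]
  apply Rat.cast_injective (α := ℝ)
  push_cast
  rw [ratCast_ratPlusSymbol_holds hf hQ, normalizedPlusSymbol, plusSymbol_eq_re_holds f hreal, Complex.ofReal_re,
    ← hcusp, hm]
  field_simp

/-- **Manin's relation for the dilated conjugate.** For `γ ∈ Γ₀(L)`, `N·t ∣ L`, `δ = diag(t,1)γdiag(t,1)⁻¹ = (a, tb; c/t, d) ∈ Γ₀(N)`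
(`Gamma0.degeneracyConjElt`) and `x ∈ ℚ` with `cx + d ≠ 0`: `j[(γx)·t]⁺_f = 𝟙_{c≠0}·j[δ∞]⁺_f + j[x·t]⁺_f` for any ring map `j` — because
`t·(γx) = δ(t x)`. [cite: Manin1972, Thm. 1.9] [cite: CremonaAlgorithms1997, §2.4 (2.4.1)–(2.4.2)] -/
theorem map_ratPlusSymbol_smul_mul_eq (hf : IsNewform0 f) (hQ : coeffField f = ⊥) {R : Type*} [NonAssocSemiring R]
    (j : ℚ →+* R) {L t : ℕ} (ht : t ≠ 0) (h : N * t ∣ L) (γ : Gamma0 L) (x : ℚ)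
    (hx : ((γ : SL(2, ℤ)) 1 0 : ℚ) * x + ((γ : SL(2, ℤ)) 1 1 : ℚ) ≠ 0) :
    j (ratPlusSymbol f (((((γ : SL(2, ℤ)) 0 0 : ℚ) * x + ((γ : SL(2, ℤ)) 0 1 : ℚ)) /
        (((γ : SL(2, ℤ)) 1 0 : ℚ) * x + ((γ : SL(2, ℤ)) 1 1 : ℚ))) * (t : ℚ))) =
      (if ((γ : SL(2, ℤ)) 1 0) = 0 then 0 else
        j (ratPlusSymbol f ((((Gamma0.degeneracyConjElt h γ : Gamma0 N) : SL(2, ℤ)) 0 0 : ℚ) /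
          (((Gamma0.degeneracyConjElt h γ : Gamma0 N) : SL(2, ℤ)) 1 0 : ℚ)))) +
      j (ratPlusSymbol f (x * (t : ℚ))) := by
  set δ : Gamma0 N := Gamma0.degeneracyConjElt h γ with hδ
  have hct : ((t : ℤ)) ∣ (γ : SL(2, ℤ)) 1 0 := by
    have hγ := γ.2
    rw [Gamma0_mem] at hγ
    exact (dvd_mul_left (t : ℤ) N).trans ((by exact_mod_cast h : ((N : ℤ) * t) ∣ (L : ℤ)).trans
      ((ZMod.intCast_zmod_eq_zero_iff_dvd _ L).mp hγ))
  have hδ10 : ((δ : SL(2, ℤ)) 1 0 : ℤ) * t = (γ : SL(2, ℤ)) 1 0 := by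
    rw [hδ, Gamma0.degeneracyConjElt_apply_one_zero]
    exact Int.ediv_mul_cancel hct
  have ht0 : (t : ℚ) ≠ 0 := by exact_mod_cast ht
  -- the point `t x` is admissible for `δ` and `δ(t x) = t·(γ x)`
  have hx' : ((δ : SL(2, ℤ)) 1 0 : ℚ) * (x * t) + ((δ : SL(2, ℤ)) 1 1 : ℚ) ≠ 0 := by
    have e : ((δ : SL(2, ℤ)) 1 0 : ℚ) * (x * t) + ((δ : SL(2, ℤ)) 1 1 : ℚ) =
        ((γ : SL(2, ℤ)) 1 0 : ℚ) * x + ((γ : SL(2, ℤ)) 1 1 : ℚ) := by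
      rw [hδ, Gamma0.degeneracyConjElt_apply_one_one, ← hδ]
      have : ((δ : SL(2, ℤ)) 1 0 : ℚ) * t = ((γ : SL(2, ℤ)) 1 0 : ℚ) := by exact_mod_cast hδ10
      rw [← this]; ring
    rw [e]; exact hx
  have hM := map_ratPlusSymbol_gamma0_smul hf hQ j δ (x * t) hx'
  simp only [] at hM
  have hpt : (((δ : SL(2, ℤ)) 0 0 : ℚ) * (x * t) + ((δ : SL(2, ℤ)) 0 1 : ℚ)) /
      (((δ : SL(2, ℤ)) 1 0 : ℚ) * (x * t) + ((δ : SL(2, ℤ)) 1 1 : ℚ)) =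
      ((((γ : SL(2, ℤ)) 0 0 : ℚ) * x + ((γ : SL(2, ℤ)) 0 1 : ℚ)) /
        (((γ : SL(2, ℤ)) 1 0 : ℚ) * x + ((γ : SL(2, ℤ)) 1 1 : ℚ))) * (t : ℚ) := by
    have e00 : ((δ : SL(2, ℤ)) 0 0 : ℚ) = ((γ : SL(2, ℤ)) 0 0 : ℚ) := by
      rw [hδ, Gamma0.degeneracyConjElt_apply_zero_zero]
    have e01 : ((δ : SL(2, ℤ)) 0 1 : ℚ) = (t : ℚ) * ((γ : SL(2, ℤ)) 0 1 : ℚ) := by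
      rw [hδ, Gamma0.degeneracyConjElt_apply_zero_one]; push_cast; ring
    have e11 : ((δ : SL(2, ℤ)) 1 1 : ℚ) = ((γ : SL(2, ℤ)) 1 1 : ℚ) := by
      rw [hδ, Gamma0.degeneracyConjElt_apply_one_one]
    have e10 : ((δ : SL(2, ℤ)) 1 0 : ℚ) * t = ((γ : SL(2, ℤ)) 1 0 : ℚ) := by exact_mod_cast hδ10
    rw [e00, e01, e11, show ((δ : SL(2, ℤ)) 1 0 : ℚ) * (x * ↑t) = (((δ : SL(2, ℤ)) 1 0 : ℚ) * t) * x by ring, e10]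
    field_simp
  have hc : ((δ : SL(2, ℤ)) 1 0 = 0) ↔ ((γ : SL(2, ℤ)) 1 0 = 0) := by
    constructor
    · intro h0; rw [← hδ10, h0, zero_mul]
    · intro h0
      have : ((δ : SL(2, ℤ)) 1 0 : ℤ) * t = 0 := by rw [hδ10, h0]
      rcases mul_eq_zero.mp this with h1 | h1
      · exact h1
      · exact absurd (by exact_mod_cast h1 : t = 0) ht
  rw [hpt] at hM
  rw [hM]
  by_cases h0 : (γ : SL(2, ℤ)) 1 0 = 0
  · rw [if_pos h0, if_pos (hc.mpr h0)]
  · rw [if_neg h0, if_neg (fun h1 ↦ h0 (hc.mp h1))]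

end Manin

/-! ## §2. The depleted table along a `Γ₀(N·∏q²)`-translate; the integer behind the difference -/

section Depleted

variable (W : WeierstrassCurve ℚ) {N : ℕ} [NeZero N] (f : CuspForm (Gamma0 N) 2)
  (S₀ : Finset (HeightOneSpectrum (𝓞 ℚ)))

omit [NeZero N] in
/-- For `k ∈ {0,1,2}^{S₀}`: `N·∏ q_v^{k_v} ∣ N·∏ q_v²`. [folklore] -/
theorem mul_prod_pow_dvd_mul_prod_sq {k : S₀ → ℕ} (hk : k ∈ Fintype.piFinset fun _ : S₀ ↦ Finset.range 3) :
    N * ∏ v : S₀, Rat.HeightOneSpectrum.natGenerator (v : HeightOneSpectrum (𝓞 ℚ)) ^ (k v) ∣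
      N * ∏ v : S₀, Rat.HeightOneSpectrum.natGenerator (v : HeightOneSpectrum (𝓞 ℚ)) ^ 2 := by
  refine mul_dvd_mul_left N (Finset.prod_dvd_prod_of_dvd _ _ fun v _ ↦ pow_dvd_pow _ ?_)
  have := Fintype.mem_piFinset.mp hk v
  rw [Finset.mem_range] at this
  omega

/-- The product `∏ q_v^{k_v}` of odd primes is non-zero. [folklore] -/
theorem prod_pow_natGenerator_ne_zero (k : S₀ → ℕ) :
    (∏ v : S₀, Rat.HeightOneSpectrum.natGenerator (v : HeightOneSpectrum (𝓞 ℚ)) ^ (k v)) ≠ 0 :=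
  Finset.prod_ne_zero_iff.mpr fun _ _ ↦ pow_ne_zero _ (Rat.HeightOneSpectrum.prime_natGenerator _).ne_zero

/-- **The depleted table along a `Γ₀(N·∏q_v²)`-translate.** For `γ ∈ Γ₀(N·∏_{v∈S₀} q_v²)` with `c(γ) ≠ 0`, a point `x` with
`cx + d ≠ 0`, and integers `m_k` with `re{∞, δ_k∞}_f = m_k·Ω⁺_f/2` for the conjugates `δ_k = diag(t_k,1)γdiag(t_k,1)⁻¹ ∈ Γ₀(N)`,
`t_k = ∏ q_v^{k_v}`: the expanded `S₀`-depleted plus table satisfies `Ψ^{S₀}(γx) = Ψ^{S₀}(x) + Σ_k C_k·(m_k/2)` in `ℚ̄₂`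
(Manin's relation factor by factor, §1). [cite: Manin1972, Thm. 1.9] [cite: GreenbergVatsal2000, §1 (8) (shape of the depletion)] -/
theorem depletedTable_gamma0_smul (hf : IsNewform0 f) (hQ : coeffField f = ⊥)
    (γ : Gamma0 (N * ∏ v : S₀, Rat.HeightOneSpectrum.natGenerator (v : HeightOneSpectrum (𝓞 ℚ)) ^ 2))
    (hc : (γ : SL(2, ℤ)) 1 0 ≠ 0) (x : ℚ) (hx : ((γ : SL(2, ℤ)) 1 0 : ℚ) * x + ((γ : SL(2, ℤ)) 1 1 : ℚ) ≠ 0)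
    (m : (S₀ → ℕ) → ℤ)
    (hm : ∀ (k : S₀ → ℕ) (hk : k ∈ Fintype.piFinset fun _ : S₀ ↦ Finset.range 3),
      (cuspSymbol f (Gamma0.degeneracyConjElt (mul_prod_pow_dvd_mul_prod_sq S₀ hk) γ)).re = m k * (plusPeriod f / 2)) :
    (∑ k ∈ Fintype.piFinset (fun _ : S₀ ↦ Finset.range 3), (∏ v : S₀, ((W.localPolynomialAt (v : HeightOneSpectrum (𝓞 ℚ))).map (Int.castRingHom (PadicAlgCl 2))).coeff (k v) * ((Rat.HeightOneSpectrum.natGenerator (v : HeightOneSpectrum (𝓞 ℚ)) : PadicAlgCl 2)⁻¹) ^ (k v)) * algebraMap ℚ (PadicAlgCl 2) (ratPlusSymbol f (((((γ : SL(2, ℤ)) 0 0 : ℚ) * x + ((γ : SL(2, ℤ)) 0 1 : ℚ)) / (((γ : SL(2, ℤ)) 1 0 : ℚ) * x + ((γ : SL(2, ℤ)) 1 1 : ℚ))) * ((∏ v : S₀, Rat.HeightOneSpectrum.natGenerator (v : HeightOneSpectrum (𝓞 ℚ)) ^ (k v) : ℕ) : ℚ)))) =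
      (∑ k ∈ Fintype.piFinset (fun _ : S₀ ↦ Finset.range 3), (∏ v : S₀, ((W.localPolynomialAt (v : HeightOneSpectrum (𝓞 ℚ))).map (Int.castRingHom (PadicAlgCl 2))).coeff (k v) * ((Rat.HeightOneSpectrum.natGenerator (v : HeightOneSpectrum (𝓞 ℚ)) : PadicAlgCl 2)⁻¹) ^ (k v)) * algebraMap ℚ (PadicAlgCl 2) (ratPlusSymbol f (x * ((∏ v : S₀, Rat.HeightOneSpectrum.natGenerator (v : HeightOneSpectrum (𝓞 ℚ)) ^ (k v) : ℕ) : ℚ)))) +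
      ∑ k ∈ Fintype.piFinset (fun _ : S₀ ↦ Finset.range 3), (∏ v : S₀, ((W.localPolynomialAt (v : HeightOneSpectrum (𝓞 ℚ))).map (Int.castRingHom (PadicAlgCl 2))).coeff (k v) * ((Rat.HeightOneSpectrum.natGenerator (v : HeightOneSpectrum (𝓞 ℚ)) : PadicAlgCl 2)⁻¹) ^ (k v)) * algebraMap ℚ (PadicAlgCl 2) ((m k : ℚ) / 2) := by
  rw [← Finset.sum_add_distrib]
  refine Finset.sum_congr rfl fun k hk ↦ ?_
  rw [← mul_add]
  congr 1
  have hδc : ((Gamma0.degeneracyConjElt (mul_prod_pow_dvd_mul_prod_sq S₀ hk) γ : Gamma0 N) : SL(2, ℤ)) 1 0 ≠ 0 := by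
    intro h0
    rw [Gamma0.degeneracyConjElt_apply_one_zero] at h0
    have hct : ((∏ v : S₀, Rat.HeightOneSpectrum.natGenerator (v : HeightOneSpectrum (𝓞 ℚ)) ^ (k v) : ℕ) : ℤ) ∣
        (γ : SL(2, ℤ)) 1 0 := by
      have hγ := γ.2
      rw [Gamma0_mem] at hγ
      exact (dvd_mul_left _ (N : ℤ)).trans ((by exact_mod_cast mul_prod_pow_dvd_mul_prod_sq S₀ hk :
        ((N : ℤ) * ((∏ v : S₀, Rat.HeightOneSpectrum.natGenerator (v : HeightOneSpectrum (𝓞 ℚ)) ^ (k v) : ℕ) : ℤ)) ∣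
          ((N * ∏ v : S₀, Rat.HeightOneSpectrum.natGenerator (v : HeightOneSpectrum (𝓞 ℚ)) ^ 2 : ℕ) : ℤ)).trans
        ((ZMod.intCast_zmod_eq_zero_iff_dvd _ _).mp hγ))
    exact hc (Int.eq_zero_of_ediv_eq_zero hct h0)
  rw [map_ratPlusSymbol_smul_mul_eq f hf hQ (algebraMap ℚ (PadicAlgCl 2)) (prod_pow_natGenerator_ne_zero S₀ k)
    (mul_prod_pow_dvd_mul_prod_sq S₀ hk) γ x hx, if_neg hc,
    ratPlusSymbol_maninCusp_eq_half_of_re f hf hQ _ hδc (hm k hk), add_comm]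

/-- **The integer behind the difference (integral form).** `(∏ q_v²)·Σ_k C_k·m_k = R` in `ℚ̄₂` with the INTEGER
`R = Σ_k (∏_v coeff_{k_v}(P_v)·q_v^{2−k_v})·m_k` (the depletion coefficients `C_k = ∏_v coeff_{k_v}(P_v)·q_v^{−k_v}` have odd
denominators). [cite: GreenbergVatsal2000, §1 (8)] -/
theorem prod_sq_mul_sum_depletionCoeff_mul_eq_intCast (m : (S₀ → ℕ) → ℤ) :
    ((∏ v : S₀, Rat.HeightOneSpectrum.natGenerator (v : HeightOneSpectrum (𝓞 ℚ)) ^ 2 : ℕ) : PadicAlgCl 2) *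
      ∑ k ∈ Fintype.piFinset (fun _ : S₀ ↦ Finset.range 3), (∏ v : S₀, ((W.localPolynomialAt (v : HeightOneSpectrum (𝓞 ℚ))).map (Int.castRingHom (PadicAlgCl 2))).coeff (k v) * ((Rat.HeightOneSpectrum.natGenerator (v : HeightOneSpectrum (𝓞 ℚ)) : PadicAlgCl 2)⁻¹) ^ (k v)) * (m k : PadicAlgCl 2) =
      ((∑ k ∈ Fintype.piFinset (fun _ : S₀ ↦ Finset.range 3), (∏ v : S₀, (W.localPolynomialAt (v : HeightOneSpectrum (𝓞 ℚ))).coeff (k v) * (Rat.HeightOneSpectrum.natGenerator (v : HeightOneSpectrum (𝓞 ℚ)) : ℤ) ^ (2 - k v)) * m k : ℤ) : PadicAlgCl 2) := by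
  push_cast
  rw [Finset.mul_sum]
  refine Finset.sum_congr rfl fun k hk ↦ ?_
  rw [← mul_assoc, ← Finset.prod_mul_distrib]
  congr 1
  refine Finset.prod_congr rfl fun v _ ↦ ?_
  have hkv : k v ≤ 2 := by
    have := Fintype.mem_piFinset.mp hk v
    rw [Finset.mem_range] at this
    omega
  have hq : (Rat.HeightOneSpectrum.natGenerator (v : HeightOneSpectrum (𝓞 ℚ)) : PadicAlgCl 2) ≠ 0 := by
    exact_mod_cast (Rat.HeightOneSpectrum.prime_natGenerator _).ne_zero
  rw [coeff_map, eq_intCast, inv_pow, pow_sub₀ _ hq hkv]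
  ring

/-- **The integer behind the difference.** `(2∏ q_v²)·Σ_k C_k·(m_k/2) = R` in `ℚ̄₂`, `R` as in
`prod_sq_mul_sum_depletionCoeff_mul_eq_intCast`. [cite: GreenbergVatsal2000, §1 (8)] -/
theorem two_mul_prod_sq_mul_sum_depletionCoeff_eq_intCast (m : (S₀ → ℕ) → ℤ) :
    ((2 * ∏ v : S₀, Rat.HeightOneSpectrum.natGenerator (v : HeightOneSpectrum (𝓞 ℚ)) ^ 2 : ℕ) : PadicAlgCl 2) *
      ∑ k ∈ Fintype.piFinset (fun _ : S₀ ↦ Finset.range 3), (∏ v : S₀, ((W.localPolynomialAt (v : HeightOneSpectrum (𝓞 ℚ))).map (Int.castRingHom (PadicAlgCl 2))).coeff (k v) * ((Rat.HeightOneSpectrum.natGenerator (v : HeightOneSpectrum (𝓞 ℚ)) : PadicAlgCl 2)⁻¹) ^ (k v)) * algebraMap ℚ (PadicAlgCl 2) ((m k : ℚ) / 2) =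
      ((∑ k ∈ Fintype.piFinset (fun _ : S₀ ↦ Finset.range 3), (∏ v : S₀, (W.localPolynomialAt (v : HeightOneSpectrum (𝓞 ℚ))).coeff (k v) * (Rat.HeightOneSpectrum.natGenerator (v : HeightOneSpectrum (𝓞 ℚ)) : ℤ) ^ (2 - k v)) * m k : ℤ) : PadicAlgCl 2) := by
  rw [← prod_sq_mul_sum_depletionCoeff_mul_eq_intCast W S₀ m, Nat.cast_mul, mul_assoc, Finset.mul_sum, Finset.mul_sum,
    Finset.mul_sum]
  refine Finset.sum_congr rfl fun k _ ↦ ?_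
  rw [map_div₀, map_intCast, map_ofNat, Nat.cast_ofNat]
  have h2 : (2 : PadicAlgCl 2) ≠ 0 := two_ne_zero
  field_simp

/-- **Reduction mod `2` of the integer `R`**: for odd `q_v`, `R ≡ Σ_k (∏_v c̄oeff_{k_v}(P_v))·m̄_k (mod 2)`. [folklore] -/
theorem intCast_sum_depletionCoeff_mul_zmod_two (hS2 : ∀ v ∈ S₀, ((2 : ℕ) : 𝓞 ℚ) ∉ v.asIdeal) (m : (S₀ → ℕ) → ℤ) :
    ((∑ k ∈ Fintype.piFinset (fun _ : S₀ ↦ Finset.range 3), (∏ v : S₀, (W.localPolynomialAt (v : HeightOneSpectrum (𝓞 ℚ))).coeff (k v) * (Rat.HeightOneSpectrum.natGenerator (v : HeightOneSpectrum (𝓞 ℚ)) : ℤ) ^ (2 - k v)) * m k : ℤ) : ZMod 2) =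
      ∑ k ∈ Fintype.piFinset (fun _ : S₀ ↦ Finset.range 3), (∏ v : S₀, ((W.localPolynomialAt (v : HeightOneSpectrum (𝓞 ℚ))).map (Int.castRingHom (ZMod 2))).coeff (k v)) * (m k : ZMod 2) := by
  push_cast
  refine Finset.sum_congr rfl fun k _ ↦ ?_
  congr 1
  refine Finset.prod_congr rfl fun v _ ↦ ?_
  have hodd : Odd (Rat.HeightOneSpectrum.natGenerator (v : HeightOneSpectrum (𝓞 ℚ))) :=
    Nat.odd_iff.mpr (Nat.two_dvd_ne_zero.mp (not_two_dvd_natGenerator (hS2 v v.2)))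
  rw [coeff_map, eq_intCast, ZMod.natCast_eq_one_iff_odd.mpr hodd, one_pow, mul_one]

end Depleted

/-! ## §3. Small norm facts in `ℚ̄₂` -/

section NormFacts

/-- An integer whose class mod `2` is non-zero is odd. [folklore] -/
theorem odd_of_intCast_zmod_two_ne_zero {R : ℤ} (h : ((R : ℤ) : ZMod 2) ≠ 0) : Odd R := by
  refine Int.not_even_iff_odd.mp fun he ↦ h ?_
  exact (ZMod.intCast_zmod_eq_zero_iff_dvd R 2).mpr (even_iff_two_dvd.mp he)

/-- An odd integer is a `2`-adic unit in `ℚ̄₂`. [folklore] -/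
theorem norm_intCast_padicAlgCl_two_eq_one_of_odd {R : ℤ} (h : Odd R) : ‖((R : ℤ) : PadicAlgCl 2)‖ = 1 := by
  rw [← map_intCast (algebraMap ℚ_[2] (PadicAlgCl 2)), PadicAlgCl.norm_extends]
  exact DepletionAtTwo.norm_intCast_eq_one_of_odd h

/-- `‖S‖ = 2` from `Q·S = R` with `‖Q‖ = 2⁻¹`, `‖R‖ = 1`. [folklore] -/
theorem norm_eq_two_of_mul_eq {Q S R : PadicAlgCl 2} (h : Q * S = R) (hQ : ‖Q‖ = 2⁻¹) (hR : ‖R‖ = 1) : ‖S‖ = 2 := by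
  have := congrArg (‖·‖) h
  simp only [norm_mul, hQ, hR] at this
  linarith [this]

/-- Ultrametric dichotomy: if `A = B + S` with `‖S‖ = 2` then `‖A‖ ≥ 2` or `‖B‖ ≥ 2`. [folklore] -/
theorem two_le_norm_or_of_eq_add {A B S : PadicAlgCl 2} (h : A = B + S) (hS : ‖S‖ = 2) : 2 ≤ ‖A‖ ∨ 2 ≤ ‖B‖ := by
  by_contra hcon
  rw [not_or, not_le, not_le] at hcon
  have hsub : A + -B = S := by rw [h]; ring
  have := IsUltrametricDist.norm_add_le_max A (-B)
  rw [hsub, hS, norm_neg] at this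
  exact absurd this (not_le.mpr (max_lt hcon.1 hcon.2))

end NormFacts

end Summit.BirchSwinnertonDyer.BirchSwinnertonDyer.Theorems.MazurTateCongruenceAtTwoR

end
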